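import Literature.MathematicalPhysics.QuantumFieldTheory.QCDCurrentSector
import Literature.MathematicalPhysics.QuantumFieldTheory.QCDSiteReflectionPositivityProofs
import Literature.MathematicalPhysics.QuantumFieldTheory.QCDTimeReflectionProofs
import Literature.MathematicalPhysics.QuantumFieldTheory.QCDPhaseQuenched

/-!
# Smeared pseudoscalar observables for the RP–Hankel form of transfer positivity
(helper for stub `stub_transferPositivity`, crux `PauliWegnerSea.ChiralOneScaleTrajectory`,
stmt-QuantumFields-17512, line `log-convex-continuum-lift`)

Torus-level bookkeeping feeding the landed odd-torus site-reflection positivity of Wilson lattice QCD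
with antiperiodic quarks (`posConst_mul_conj_integral_nonneg`, Montvay–Münster §4.2.3 (4.90)–(4.110);
Lüscher 1977; Osterwalder–Seiler 1978) with U-INDEPENDENT positive-time quark polynomials:

* the torus bilinear `ψ̄_f(x) Γ M ψ_g(y)` is even (hence central), and the site reflection `Θ_T` maps the
  pseudoscalar density `ψ̄_f(x) γ₅ ψ_g(y)` to `−ψ̄_g(θy) γ₅ ψ_f(θx)` (`γ₀ γ₅ γ₀ = −γ₅`);
* a gauge-invariant element `F₀` of the boxed quark algebra is (the value of) a local observable with empty
  link support; if it lies in the positive-time subalgebra the positivity theorem applies to it: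
  `0 ≤ c₀ · conj ∫ ∫dψ̄dψ F₀ (Θ_T F₀) e^{−ψ̄D^{AP}ψ} dμ_W`;
* the Berezin–Wilson functional `x ↦ ∫ ∫dψ̄dψ x e^{−ψ̄D^{AP}(V)ψ} dμ_W(V)` is integrable for every fixed `x`
  (bounded measurable coefficients), hence finitely additive: expansion of products of finite linear
  combinations.
-/

noncomputable section

namespace Summit.QuantumFields.QCD.Cruxes.ChiralOneScaleTrajectory.LogConvexLift.TransferPositivity

open scoped BigOperators ComplexOrder ComplexConjugate
open MeasureTheory Filter
open Literature.MathematicalPhysics.QuantumFieldTheory Literature.MathematicalPhysics.QuantumLattice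
  Literature.Probability.LatticeModels

variable {Nf : ℕ}

/-! ### The torus bilinear: parity and reflection -/

section TorusBilinear

variable {L : ℕ} [NeZero L]

/-- The quark bilinear `ψ̄_f(x) Γ M ψ_g(y)` is an even element of the torus Grassmann algebra. -/
theorem torusBilinear_mem_evenOdd_zero (f g : Fin Nf) (x y : TorusSite 4 L) (Γ : Matrix (Fin 4) (Fin 4) ℂ)
    (M : Matrix (Fin 3) (Fin 3) ℂ) :
    torusBilinear f g x y Γ M ∈ GrassmannAlgebra.evenOdd ℂ (ι := FermiIdx Nf L ⊕ₗ FermiIdx Nf L) 0 := by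
  unfold torusBilinear
  refine Submodule.sum_mem _ fun α _ => Submodule.sum_mem _ fun β _ => Submodule.sum_mem _ fun a _ =>
    Submodule.sum_mem _ fun b _ => Submodule.smul_mem _ _ ?_
  exact GrassmannAlgebra.psiBar_mul_psi_mem_evenOdd_zero ℂ _ _

/-- Even elements are central: the quark bilinear commutes with everything. -/
theorem mul_torusBilinear_comm (f g : Fin Nf) (x y : TorusSite 4 L) (Γ : Matrix (Fin 4) (Fin 4) ℂ)
    (M : Matrix (Fin 3) (Fin 3) ℂ) (a : FermiAlg Nf L) :
    a * torusBilinear f g x y Γ M = torusBilinear f g x y Γ M * a :=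
  ((GrassmannAlgebra.commute_of_mem_evenOdd_zero ℂ (torusBilinear_mem_evenOdd_zero f g x y Γ M) a).eq).symm

/-- The colour-singlet pseudoscalar bilinear written out: `ψ̄_f(x) γ₅ ψ_g(y) = Σ_{a,α} (γ₅)_{αα} ψ̄_{f,x,a,α} ψ_{g,y,a,α}`
(`γ₅ = diag(1,1,−1,−1)` in the chiral basis). -/
theorem torusBilinear_gammaFive_one (f g : Fin Nf) (x y : TorusSite 4 L) :
    torusBilinear f g x y gammaFive 1 =
      ∑ a : Fin 3, ∑ α : Fin 4, ((![1, 1, -1, -1] : Fin 4 → ℂ) α) • (qbar (f, (x, a, α)) * q (g, (y, a, α))) := by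
  unfold torusBilinear
  rw [gammaFive_eq_diagonal]
  simp only [Matrix.diagonal_apply, Matrix.one_apply, mul_ite, mul_one, mul_zero, ite_smul, zero_smul,
    Finset.sum_ite_eq, Finset.sum_ite_irrel, Finset.sum_const_zero, Finset.mem_univ, if_true]
  exact Finset.sum_comm

/-- `γ₀ γ₅† γ₀ = −γ₅` entrywise, in the form produced by the reflection of `ψ̄ γ₅ ψ`. -/
theorem sum_conj_gammaFiveSign_mul_gamma_zero (β' α' : Fin 4) :
    ∑ α : Fin 4, conj ((![1, 1, -1, -1] : Fin 4 → ℂ) α) * (euclideanGamma 0 β' α * euclideanGamma 0 α α') =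
      if β' = α' then -(![1, 1, -1, -1] : Fin 4 → ℂ) β' else 0 := by
  fin_cases β' <;> fin_cases α' <;> simp [euclideanGamma_zero, Fin.sum_univ_four]

/-- **The site reflection of the pseudoscalar density**: `Θ_T (ψ̄_f(x) γ₅ ψ_g(y)) = −ψ̄_g(θy) γ₅ ψ_f(θx)`
(antilinear, order reversing, `Θψ = ψ̄γ₀`, `Θψ̄ = γ₀ψ`, and `γ₀ γ₅ γ₀ = −γ₅`; Montvay–Münster (4.99)). -/
theorem torusTheta_torusBilinear_gammaFive (f g : Fin Nf) (x y : TorusSite 4 L) :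
    torusTheta (torusBilinear f g x y gammaFive 1) =
      -torusBilinear g f (Site.negReflect y) (Site.negReflect x) gammaFive 1 := by
  rw [torusBilinear_gammaFive_one, torusBilinear_gammaFive_one, map_sum, ← Finset.sum_neg_distrib]
  refine Finset.sum_congr rfl fun a _ => ?_
  rw [map_sum]
  simp only [torusTheta_smul', torusTheta_mul, torusTheta_q, torusTheta_qbar, starRingEnd_apply]
  simp only [Finset.sum_mul, Finset.mul_sum, smul_mul_smul_comm, Finset.smul_sum, smul_smul]
  rw [Finset.sum_comm]
  refine (Finset.sum_congr rfl fun β' _ => Finset.sum_comm).trans ?_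
  simp only [← Finset.sum_smul]
  simp only [← starRingEnd_apply, sum_conj_gammaFiveSign_mul_gamma_zero, ite_smul, zero_smul,
    Finset.sum_ite_eq', Finset.mem_univ, if_true, neg_smul, Finset.sum_neg_distrib]

end TorusBilinear

/-! ### The boxed bilinear: placing, gauge invariance, positive time -/

section Box

variable {R : ℕ}

/-- Placing the boxed bilinear `ψ̄_f(x) Γ M ψ_g(y)` at `v` on the torus of side `S` gives the torus bilinear
between the translated sites. -/
theorem map_placeLin_boxBilinear {S : ℕ} [NeZero S] (v : Site 4) (f g : Fin Nf) (x y : ↥(box 4 R))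
    (Γ : Matrix (Fin 4) (Fin 4) ℂ) (M : Matrix (Fin 3) (Fin 3) ℂ) :
    ExteriorAlgebra.map (placeLin Nf R S v) (boxBilinear f g x y Γ M) =
      torusBilinear f g (Torus.proj S ((x : Site 4) + v)) (Torus.proj S ((y : Site 4) + v)) Γ M := by
  simp only [boxBilinear, torusBilinear, map_sum, map_smul, map_mul, map_place_boxQbar, map_place_boxQ]

/-- The colour-singlet local bilinear `ψ̄_f(x) Γ ψ_g(x)` is gauge invariant. -/
theorem fermiGaugeAct_boxBilinear_one (u : Site 4 → (Matrix.specialUnitaryGroup (Fin 3) ℂ)) (f g : Fin Nf) (x : ↥(box 4 R))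
    (Γ : Matrix (Fin 4) (Fin 4) ℂ) : fermiGaugeAct u (boxBilinear f g x x Γ 1) = boxBilinear f g x x Γ 1 := by
  rw [fermiGaugeAct_boxBilinear, Matrix.mul_one, specialUnitary_coe_inv_mul_coe]

/-- A boxed bilinear between sites at times `≥ 1` lies in the positive-time subalgebra. -/
theorem boxBilinear_mem_positiveTimeSubalgebra (f g : Fin Nf) (x y : ↥(box 4 R)) (Γ : Matrix (Fin 4) (Fin 4) ℂ)
    (M : Matrix (Fin 3) (Fin 3) ℂ) (hx : 1 ≤ (x : Site 4) 0) (hy : 1 ≤ (y : Site 4) 0) :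
    boxBilinear f g x y Γ M ∈ positiveTimeSubalgebra Nf R := by
  unfold boxBilinear
  refine Subalgebra.sum_mem _ fun α _ => Subalgebra.sum_mem _ fun β _ => Subalgebra.sum_mem _ fun a _ =>
    Subalgebra.sum_mem _ fun b _ => Subalgebra.smul_mem _ (Subalgebra.mul_mem _ ?_ ?_) _
  · refine Algebra.subset_adjoin ⟨toLex (Sum.inl (boxQuarkEquiv (f, (x, a, α)))), ?_, rfl⟩
    simpa [genTime] using hx
  · refine Algebra.subset_adjoin ⟨toLex (Sum.inr (boxQuarkEquiv (g, (y, b, β)))), ?_, rfl⟩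
    simpa [genTime] using hy

/-- **A gauge-invariant constant is a local observable with empty link support.** -/
theorem exists_obs_const (F₀ : BoxFermiAlg Nf R)
    (hg : ∀ u : Site 4 → Matrix.specialUnitaryGroup (Fin 3) ℂ, fermiGaugeAct u F₀ = F₀) :
    ∃ A : QCDLatticeObservable Nf R, A.supp = ∅ ∧ ∀ U, A.F U = F₀ :=
  ⟨⟨fun _ => F₀, ∅, fun _ _ _ => rfl, fun u _ => hg u, fun _ => ⟨_, fun _ => le_rfl⟩, fun _ => measurable_const⟩,
    rfl, fun _ => rfl⟩

end Box

/-! ### Positivity for positive-time gauge-invariant constants -/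

section Positivity

/-- **Site-reflection positivity for a U-independent positive-time quark polynomial** (`posConst_mul_conj_integral_nonneg`
applied to the constant observable): on the odd torus `2S+1`, for `F₀` gauge invariant in the positive-time subalgebra of
the box of radius `S`, `0 ≤ c₀ · conj ∫ ∫dψ̄dψ x (Θ_T x) e^{−ψ̄D^{AP}(V)ψ} dμ_W(V)` with `x` the placed `F₀`. -/
theorem posConst_mul_conj_integral_nonneg_const {S : ℕ} (hS : 1 ≤ S) (F₀ : BoxFermiAlg Nf S)
    (hg : ∀ u : Site 4 → Matrix.specialUnitaryGroup (Fin 3) ℂ, fermiGaugeAct u F₀ = F₀)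
    (hpos : F₀ ∈ positiveTimeSubalgebra Nf S)
    (mq : Fin Nf → ℝ) (hm : ∀ f, -1 < mq f) {β : ℝ} (hβ : 0 ≤ β) {cN : ℂ}
    (hcN : fermiThetaRot (GrassmannAlgebra.grassmannBasis ℂ _ (posGens Nf (2 * S + 1))) =
      cN • GrassmannAlgebra.grassmannBasis ℂ _ (negGens Nf (2 * S + 1))) :
    0 ≤ posConst (Nf := Nf) (L := 2 * S + 1) cN *
      conj (∫ V : GaugeConfig 4 (2 * S + 1) (Matrix.specialUnitaryGroup (Fin 3) ℂ),
        fermiIntegral (ExteriorAlgebra.map (placeLin Nf S (2 * S + 1) 0) F₀ *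
          torusTheta (ExteriorAlgebra.map (placeLin Nf S (2 * S + 1) 0) F₀) * fermiBoltzmannAP V mq)
        ∂(wilsonMeasure (fundamentalRep (Fin 3)) β)) := by
  obtain ⟨A, hAsupp, hAF⟩ := exists_obs_const F₀ hg
  have hA : A.IsPositiveTime := ⟨fun e he => by simp [hAsupp] at he, fun U => by rw [hAF]; exact hpos⟩
  have hE : A.LinksEndBy S := fun e he => by simp [hAsupp] at he
  have hon : ∀ V : GaugeConfig 4 (2 * S + 1) (Matrix.specialUnitaryGroup (Fin 3) ℂ),
      A.onTorus (2 * S + 1) 0 V = ExteriorAlgebra.map (placeLin Nf S (2 * S + 1) 0) F₀ := fun V => by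
    unfold QCDLatticeObservable.onTorus
    rw [hAF]
  have h := posConst_mul_conj_integral_nonneg (L := 2 * S + 1) A mq rfl hS (by omega) hA hE hm hβ hcN
  simp only [osAdjoint_onTorus_zero, hon] at h
  exact h

end Positivity

/-! ### Integrability and finite additivity of the Berezin–Wilson functional -/

section Integrable

variable {L : ℕ}

/-- For a continuous representation `ρ` of a topological group the antiperiodic Wilson–Dirac matrix depends
continuously on the gauge field (entries: constants plus finite sums of `ρ(U_e)_{ab}`, `ρ(U_e⁻¹)_{ab}` times fixed
signs and spin matrices). -/
theorem continuous_wilsonDiracAP' {n : ℕ} {G : Type*} [Group G] [TopologicalSpace G] [IsTopologicalGroup G]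
    (ρ : G →* Matrix (Fin n) (Fin n) ℂ) (hρ : Continuous ρ) (m r : ℝ) :
    Continuous fun U : GaugeConfig 4 L G => wilsonDiracAP ρ U m r := by
  refine continuous_pi fun p => continuous_pi fun q => ?_
  simp only [wilsonDiracAP, Matrix.of_apply]
  refine continuous_const.sub (continuous_const.mul (continuous_finsetSum _ fun μ _ => ?_))
  refine Continuous.add ?_ ?_
  · split_ifs
    · exact continuous_const.mul (continuous_const.mul ((hρ.comp (continuous_apply _)).matrix_elem _ _))
    · exact continuous_const
  · split_ifs
    · exact continuous_const.mul (continuous_const.mul ((hρ.comp ((continuous_apply _).inv)).matrix_elem _ _))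
    · exact continuous_const

variable [NeZero L]

/-- The `N_f`-flavour antiperiodic Dirac matrix depends continuously on the gauge field. -/
theorem continuous_diracMatrixAP_fundamental (mq : Fin Nf → ℝ) :
    Continuous fun U : GaugeConfig 4 L (Matrix.specialUnitaryGroup (Fin 3) ℂ) => diracMatrixAP U mq := by
  unfold diracMatrixAP
  refine continuous_pi fun i => continuous_pi fun j => ?_
  simp only [Matrix.reindex_apply, Matrix.submatrix_apply, Matrix.of_apply]
  split_ifs
  · exact (continuous_wilsonDiracAP' (fundamentalRep (Fin 3)) (continuous_fundamentalRep (Fin 3)) _ _).matrix_elem _ _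
  · exact continuous_const

/-- The antiperiodic fermionic Boltzmann factor is coefficient-regular in the gauge field. -/
theorem coeffRegular_fermiBoltzmannAP (mq : Fin Nf → ℝ) :
    GrassmannAlgebra.CoeffRegular (fun V : GaugeConfig 4 L (Matrix.specialUnitaryGroup (Fin 3) ℂ) => fermiBoltzmannAP V mq) := by
  unfold fermiBoltzmannAP
  exact (coeffRegular_quadratic fun p q =>
    (continuous_diracMatrixAP_fundamental mq).neg.matrix_elem p q).grassmannExp fun U => coord_empty_quadratic _

/-- **Integrability**: for a fixed `x`, `V ↦ ∫dψ̄dψ x e^{−ψ̄D^{AP}(V)ψ}` is bounded and measurable, hence integrable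
against the Wilson probability measure. -/
theorem integrable_fermiIntegral_const_mul (x : FermiAlg Nf L) (mq : Fin Nf → ℝ) (β : ℝ) :
    Integrable (fun V : GaugeConfig 4 L (Matrix.specialUnitaryGroup (Fin 3) ℂ) =>
      fermiIntegral (x * fermiBoltzmannAP V mq)) (wilsonMeasure (fundamentalRep (Fin 3)) β) := by
  have h : GrassmannAlgebra.CoeffRegular (fun V : GaugeConfig 4 L (Matrix.specialUnitaryGroup (Fin 3) ℂ) =>
      x * fermiBoltzmannAP V mq) :=
    (GrassmannAlgebra.coeffRegular_const x).mul (coeffRegular_fermiBoltzmannAP mq)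
  obtain ⟨C, hC⟩ := h.exists_norm_apply_le fermiIntegral
  exact Integrable.of_bound (h.measurable_apply fermiIntegral).aestronglyMeasurable C (Eventually.of_forall hC)

/-- **Expansion of a `2 × 2` product** under the Berezin–Wilson functional. -/
theorem integral_fermiIntegral_pair_expand (x₁ x₂ y₁ y₂ : FermiAlg Nf L) (a₁ a₂ b₁ b₂ : ℂ) (mq : Fin Nf → ℝ)
    (β : ℝ) :
    ∫ V : GaugeConfig 4 L (Matrix.specialUnitaryGroup (Fin 3) ℂ),
        fermiIntegral ((a₁ • x₁ + a₂ • x₂) * (b₁ • y₁ + b₂ • y₂) * fermiBoltzmannAP V mq)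
        ∂(wilsonMeasure (fundamentalRep (Fin 3)) β) =
      a₁ * b₁ * ∫ V : GaugeConfig 4 L (Matrix.specialUnitaryGroup (Fin 3) ℂ),
          fermiIntegral (x₁ * y₁ * fermiBoltzmannAP V mq)
          ∂(wilsonMeasure (fundamentalRep (Fin 3)) β) +
      a₁ * b₂ * ∫ V : GaugeConfig 4 L (Matrix.specialUnitaryGroup (Fin 3) ℂ), fermiIntegral (x₁ * y₂ * fermiBoltzmannAP V mq)
          ∂(wilsonMeasure (fundamentalRep (Fin 3)) β) +
      a₂ * b₁ * ∫ V : GaugeConfig 4 L (Matrix.specialUnitaryGroup (Fin 3) ℂ), fermiIntegral (x₂ * y₁ * fermiBoltzmannAP V mq)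
          ∂(wilsonMeasure (fundamentalRep (Fin 3)) β) +
      a₂ * b₂ * ∫ V : GaugeConfig 4 L (Matrix.specialUnitaryGroup (Fin 3) ℂ), fermiIntegral (x₂ * y₂ * fermiBoltzmannAP V mq)
          ∂(wilsonMeasure (fundamentalRep (Fin 3)) β) := by
  have hpt : ∀ V : GaugeConfig 4 L (Matrix.specialUnitaryGroup (Fin 3) ℂ),
      fermiIntegral ((a₁ • x₁ + a₂ • x₂) * (b₁ • y₁ + b₂ • y₂) * fermiBoltzmannAP V mq) =
        a₁ * b₁ * fermiIntegral (x₁ * y₁ * fermiBoltzmannAP V mq) +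
        a₁ * b₂ * fermiIntegral (x₁ * y₂ * fermiBoltzmannAP V mq) +
        a₂ * b₁ * fermiIntegral (x₂ * y₁ * fermiBoltzmannAP V mq) +
        a₂ * b₂ * fermiIntegral (x₂ * y₂ * fermiBoltzmannAP V mq) := fun V => by
    simp only [add_mul, mul_add]
    simp only [smul_mul_smul_comm]
    simp only [smul_mul_assoc, map_add, map_smul, smul_eq_mul]
    ring
  simp_rw [hpt]
  have hI : ∀ x y : FermiAlg Nf L, Integrable (fun V : GaugeConfig 4 L (Matrix.specialUnitaryGroup (Fin 3) ℂ) =>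
      fermiIntegral (x * y * fermiBoltzmannAP V mq)) (wilsonMeasure (fundamentalRep (Fin 3)) β) := fun x y =>
    integrable_fermiIntegral_const_mul (x * y) mq β
  rw [integral_add, integral_add, integral_add, integral_const_mul, integral_const_mul, integral_const_mul,
    integral_const_mul]
  · exact (hI x₁ y₁).const_mul _
  · exact (hI x₁ y₂).const_mul _
  · exact ((hI x₁ y₁).const_mul _).add ((hI x₁ y₂).const_mul _)
  · exact (hI x₂ y₁).const_mul _
  · exact (((hI x₁ y₁).const_mul _).add ((hI x₁ y₂).const_mul _)).add ((hI x₂ y₁).const_mul _)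
  · exact (hI x₂ y₂).const_mul _

/-- **Expansion of a product of finite linear combinations** under the Berezin–Wilson functional. -/
theorem integral_fermiIntegral_sum_mul_sum {ι κ : Type*} (s : Finset ι) (t : Finset κ) (a : ι → ℂ) (b : κ → ℂ)
    (x : ι → FermiAlg Nf L) (y : κ → FermiAlg Nf L) (mq : Fin Nf → ℝ) (β : ℝ) :
    ∫ V : GaugeConfig 4 L (Matrix.specialUnitaryGroup (Fin 3) ℂ),
        fermiIntegral ((∑ i ∈ s, a i • x i) * (∑ j ∈ t, b j • y j) * fermiBoltzmannAP V mq)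
        ∂(wilsonMeasure (fundamentalRep (Fin 3)) β) =
      ∑ i ∈ s, ∑ j ∈ t, a i * b j * ∫ V : GaugeConfig 4 L (Matrix.specialUnitaryGroup (Fin 3) ℂ),
          fermiIntegral (x i * y j * fermiBoltzmannAP V mq) ∂(wilsonMeasure (fundamentalRep (Fin 3)) β) := by
  have hpt : ∀ V : GaugeConfig 4 L (Matrix.specialUnitaryGroup (Fin 3) ℂ),
      fermiIntegral ((∑ i ∈ s, a i • x i) * (∑ j ∈ t, b j • y j) * fermiBoltzmannAP V mq) =
        ∑ i ∈ s, ∑ j ∈ t, a i * b j * fermiIntegral (x i * y j * fermiBoltzmannAP V mq) := fun V => by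
    rw [Finset.sum_mul, Finset.sum_mul, map_sum]
    refine Finset.sum_congr rfl fun i _ => ?_
    rw [Finset.mul_sum, Finset.sum_mul, map_sum]
    refine Finset.sum_congr rfl fun j _ => ?_
    rw [smul_mul_smul_comm, smul_mul_assoc, map_smul, smul_eq_mul]
  simp_rw [hpt]
  rw [integral_finsetSum _ fun i _ => integrable_finsetSum _ fun j _ =>
    (integrable_fermiIntegral_const_mul (x i * y j) mq β).const_mul _]
  refine Finset.sum_congr rfl fun i _ => ?_
  rw [integral_finsetSum _ fun j _ => (integrable_fermiIntegral_const_mul (x i * y j) mq β).const_mul _]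
  refine Finset.sum_congr rfl fun j _ => ?_
  exact integral_const_mul _ _

end Integrable

/-! ### Registered helper sub-goal -/

/-- **Registered helper sub-goal `stub_transferPositivity_auxObs` of stub `stub_transferPositivity`**: site-reflection
positivity for a U-independent, gauge-invariant, positive-time quark polynomial `F₀` on the odd torus `2S+1` — the
un-normalised form `0 ≤ c₀ · conj ∫ ∫dψ̄dψ x (Θ_T x) e^{−ψ̄D^{AP}ψ} dμ_W` with `x` the placed `F₀`
(`posConst_mul_conj_integral_nonneg_const`). -/
theorem stub_transferPositivity_auxObs : ∀ {Nf S : ℕ}, 1 ≤ S → ∀ (F₀ : BoxFermiAlg Nf S), (∀ u : Site 4 → Matrix.specialUnitaryGroup (Fin 3) ℂ, fermiGaugeAct u F₀ = F₀) → F₀ ∈ positiveTimeSubalgebra Nf S → ∀ (mq : Fin Nf → ℝ), (∀ f, -1 < mq f) → ∀ {β : ℝ}, 0 ≤ β → ∀ {cN : ℂ}, fermiThetaRot (GrassmannAlgebra.grassmannBasis ℂ _ (posGens Nf (2 * S + 1))) = cN • GrassmannAlgebra.grassmannBasis ℂ _ (negGens Nf (2 * S + 1)) → 0 ≤ posConst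 (Nf := Nf) (L := 2 * S + 1) cN * (starRingEnd ℂ) (∫ V : GaugeConfig 4 (2 * S + 1) (Matrix.specialUnitaryGroup (Fin 3) ℂ), fermiIntegral (ExteriorAlgebra.map (placeLin Nf S (2 * S + 1) 0) F₀ * torusTheta (ExteriorAlgebra.map (placeLin Nf S (2 * S + 1) 0) F₀) * fermiBoltzmannAP V mq) ∂(wilsonMeasure (fundamentalRep (Fin 3)) β)) :=
  fun hS F₀ hg hpos mq hm _ hβ _ hcN => posConst_mul_conj_integral_nonneg_const hS F₀ hg hpos mq hm hβ hcN

end Summit.QuantumFields.QCD.Cruxes.ChiralOneScaleTrajectory.LogConvexLift.TransferPositivity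

end
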